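import Summits.QuantumFields.YangMills.Theorems.BalabanUVNodesN27AtRecord13CoPHHolder
import Summits.QuantumFields.YangMills.Theorems.BalabanUVNodesN14AtTopBornTower

/-!
# BalabanUVNodes ∕ N27 = binder B5 AT THE RECORD — THE R-β TWIN OF XXXIXᶜᵒᵖᴴ-HomeOnN14 (`…N27AtRecord13CoPHHomeOnN14`, p547998): the regime-home knit at node N16's
# currency of record «R-β» ((Q) `…N27AtRecord13CoPHHolder` §1 `spine_rec13CCoPHOn_of_homes₁₃CoPHOn_holder`, p581033) WITH THE N14 SLOT IN dag-n14's THREE CURRENCIES —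
# (a) NE1′'s θ-level form `N14At (𝔯.ne1 F θ hP g₀ os)`, (b) END-B uniform leaves, (c) the TOP-BORN form of director-ym №195 (8) reading (a) (dag-n14-w1 `…N14AtTopBornTower`,
# p584515) — at a generic regime and at the guard of record (W-SEAT-START-LIST v4∕v5 §2 n27 (W-c) № 1; plan g79 REBALANCE word (D) INBOX l.24699 «n14-w2 → (W-c) № 1»;
# dag-n27-c g11 l.24766 «(W-c) № 1 HomeOnN14 R-β twin is n14-w2's; my T1∕T2∕G never state the `_n14At ∕ _uniformLeaves` homes faces»)

Cell `pub-ymgap`, HUMAN RULING D-0062 ∕ D-0149, width seat `pub-ymgap-dag-n14-w2` (g0); K3⁷ `SpineGivenEndpointR13SepCoPH` = stmt-QuantumFields-20544, `--kind proof --supports 20544 --as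
helper`; COUNT-NEUTRAL; THEOREMS ONLY (0 `def`, 0 `sorry`); `N`-generic, regime-generic, NO Theses import (the item-facing face at `N = 2` is ONE application of n27-c's leaf E
`…N27SpineGivenEndpointR13SepCoPHHolder` at the call site).  ADDITIVE: imports (Q) and dag-n14-w1's top-born module ONLY (through them XXXIXᶜᵒᵖᴴ, n16-e 41ᴴ `…SpineRatesHolder`, n14-c g9
`…N14AtRateRecord13CoPHOn`); modifies nothing; the β = 1 parent p547998 and every landed decl UNTOUCHED.

RECIPE (n27-c g10's (W-a)–(W-d) kit word, START-LIST §2 n27): the β = 1 parent's four theorems with `h16 : S_N16 ↦ S_N16Holder β`, `h19`'s `RatesAt ↦ RatesHolderAt … β`, base knit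
`spine_rec13CCoPHOn_of_homes₁₃CoPHOn ↦ spine_rec13CCoPHOn_of_homes₁₃CoPHOn_holder cr β`; plus the third N14 currency (c), new at the homes level (n27-c g11's T1 states it at the READING level).

WHAT IS KERNEL-CHECKED ([bookkeeping]; proofs = ONE application each):
* §1 (generic regime `Rg`, RR-2's regime record class `Node00.IsRecordOfRecord₁₃CCoPHOn F N Rg`): `spine_rec13CCoPHOn_of_homes₁₃CoPHOn_holder_n14At` (N14 from NE1′'s θ-form via n14-c
  `s_N14_rRec₁₃CoPHOn_of_n14At`) · `…_holder_uniformLeaves` (N14 from END-B uniform leaves via `s_N14_rRec₁₃CoPHOn_of_uniformLeaves`) · ★ `…_holder_topBorn` (N14 from a TOP-BORN dressed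
  tower with ONE K-∕p-uniform top-size bound and `0 ≤ Λ` via n14-w1 `YMDAG.N14.TopBorn.s_N14_rRec₁₃CoPHOn_of_topBorn` — the currency K3⁷ v2 pins BY NAME, plan g78 l.24332).
* §2 the three at the guard of record `Rg := Node00.unityNondeg₁₃H N` (print's partition of unity `θ.ZhUnity F N` and non-degenerate present slots), landing in RR-2's CN class
  `Node00.IsRecordOfRecord₁₃CCoPHN F N` — at `N = 2` one application of leaf E short of K3⁷: `spine_rec13CCoPHN_of_homes₁₃CoPHOn_holder_n14At ∕ _uniformLeaves ∕ _topBorn`.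

HONEST FRAMING.  COMPOSITE-node bookkeeping BY NAME: every K4∕K5 stub, the extraction clause, the R-β edge AND the N14 antecedent (NE1′'s θ-form ∕ uniform leaves ∕ the top-born
budget for the reading's dressed tower `𝔯.ne1` — a PARAMETER; the top-born reading is the director's ADOPTED TABLE READING (a), not a theorem about Bałaban's run, n14-w1 §4 LOCATED)
are HYPOTHESES (0∕1 at the ₁₃ record today); `β` is a LETTER (the consumers' window `2∕3 < β < 1` is theirs); the readings `cr`, `𝔯` are PARAMETERS; nothing of Bałaban's asserted
or instantiated; NE1′ ∕ NE3 at exponent β ∕ NE7-cluster NOT PRINTED for d = 4 and NOT PROVED; no `Provisos₁₃CoPH` inhabitant claimed (K0⁷ open); N14 ∕ N16 ∕ N27 NOT discharged; K3⁷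
OPEN, NOT claimed; counts UNMOVED (typed 28∕28 · discharged 5∕27, A 5∕28); one finite four-torus programme at fixed `ε`; R4 closes only the conditional finite-𝕋⁴ rung `BalabanLadder.UV`
— NOT ℝ⁴, NOT infinite volume, NOT OS, NOT a mass gap, NOT Clay.  No decl below carries a cite tag.
-/

set_option autoImplicit false

namespace Summit.QuantumFields.YangMills.Theorems.BalabanUVNodesN27SpineRecord

open Literature.MathematicalPhysics.QuantumFieldTheory.Balaban1983to89
open Literature.MathematicalPhysics.QuantumFieldTheory.Balaban1983to89.T4Continuum
open T4ContinuumYM4Torus (ForSmallCouplings)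
open Summit.QuantumFields.BalabanUV.T4Continuum.Spine
open Summit.QuantumFields.BalabanUV.T4Continuum.NE1p.DressedRoot (UniformConstants BookingLeaves)
open YMDAG.UVSplit
open YMDAG.N14 (s_N14_rRec₁₃CoPHOn_of_n14At s_N14_rRec₁₃CoPHOn_of_uniformLeaves)
open YMDAG.N14.TopBorn (TowerTopBorn TowerTopSizeLe s_N14_rRec₁₃CoPHOn_of_topBorn)
open Summit.QuantumFields.YangMills.BalabanUVNodes.N16HolderDefs (S_N16Holder)
open Summit.QuantumFields.YangMills.BalabanUVNodes.SpineRatesHolder (RatesHolderAt)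
open Node00 (Stage13HParams datumOfRecord₁₃CoPH)

variable {N : ℕ} [NeZero N] (cr : SpineReading₁₃CoPH N) (β : ℝ) (𝔯 : RateReading₁₃CoPH N) (Rg : (F : T4Family) → Stage13HParams F N → Prop)

/-! ## §1 The R-β regime-home knit with N14 in NE1′'s θ-level ∕ END-B uniform-leaves ∕ TOP-BORN currency -/

/-- **N27 = B5 AT THE REGIME RECORD CLASS, β-RATES, N14 READ AS NE1′ AT THE READING'S DRESSED TOWER**: (Q) §1 `spine_rec13CCoPHOn_of_homes₁₃CoPHOn_holder` with its first hypothesis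
`S_N14 (RRec₁₃CoPHOn 𝔯 Rg)` supplied by dag-n14-c's knit `s_N14_rRec₁₃CoPHOn_of_n14At` from «`N14At (𝔯.ne1 F θ hP g₀ os)` at every admissible tuple with provisos in the regime»; N16 at
exponent `β` (`S_N16Holder β`), the N19′ edge reading `RatesHolderAt … β`.  Every hypothesis 0∕1 today. [bookkeeping] -/
theorem spine_rec13CCoPHOn_of_homes₁₃CoPHOn_holder_n14At
    (h14 : ∀ (F : T4Family) (θ : Stage13HParams F N) (hP : θ.Provisos₁₃CoPH F N), Rg F θ → θ.Admissible F N →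
      ∀ (g₀ : ℕ → ℝ) (os : List (ULoop F)), N14At (𝔯.ne1 F θ hP g₀ os))
    (h15 : S_N15 (RRec₁₃CoPHOn 𝔯 Rg)) (h16 : S_N16Holder β (RRec₁₃CoPHOn 𝔯 Rg)) (h17 : S_N17 (RRec₁₃CoPHOn 𝔯 Rg))
    (h18 : S_N18 (RRec₁₃CoPHOn 𝔯 Rg)) (h22 : S_N22 (RRec₁₃CoPHOn 𝔯 Rg)) (h20 : S_N20 (SRec₁₃CoPHOn cr Rg)) (h21 : S_N21 (SRec₁₃CoPHOn cr Rg))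
    (hx : ∀ (F : T4Family) (θ : Stage13HParams F N) (hP : θ.Provisos₁₃CoPH F N), Rg F θ → θ.Admissible F N →
      B16.EndStatementBPrinted (datumOfRecord₁₃CoPH F N θ hP).C → DagBinding.EndpointExistence (datumOfRecord₁₃CoPH F N θ hP).C.toB12 →
        ForSmallCouplings (datumOfRecord₁₃CoPH F N θ hP) fun g₀ => ∀ os : List (ULoop F),
          0 < (cr F θ hP g₀ os).l₀ ∧ 0 < (cr F θ hP g₀ os).vol ∧
          (∀ (K : ℕ) (t : ℝ), |t| ≤ (cr F θ hP g₀ os).l₀ →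
            T4GenFunBounds.schemeZ ((datumOfRecord₁₃CoPH F N θ hP).scheme g₀) os ((cr F θ hP g₀ os).K₀ + K) t =
              ∑ τ ∈ (cr F θ hP g₀ os).T K, (cr F θ hP g₀ os).A K t τ) ∧
          (∀ (K : ℕ) (t : ℝ), |t| ≤ (cr F θ hP g₀ os).l₀ →
            T4GenFunBounds.schemeZ ((datumOfRecord₁₃CoPH F N θ hP).scheme g₀) os ((cr F θ hP g₀ os).K₀ + K + 1) t =
              ∑ τ ∈ (cr F θ hP g₀ os).T K, (cr F θ hP g₀ os).B K t τ))
    (h19 : ∀ (F : T4Family) (θ : Stage13HParams F N) (hP : θ.Provisos₁₃CoPH F N), Rg F θ → θ.Admissible F N → ∀ (g₀ : ℕ → ℝ) (os : List (ULoop F)),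
      (∀ k : ℕ, RatesHolderAt (datumOfRecord₁₃CoPH F N θ hP) (rateCarriersOfRecord₁₃CoPH 𝔯 F θ hP g₀ os k) β) → letI := (cr F θ hP g₀ os).dec
        ∃ δ : ℕ → ℝ, NE7.Core (cr F θ hP g₀ os).l₀ (cr F θ hP g₀ os).vol (cr F θ hP g₀ os).T (cr F θ hP g₀ os).Bad
          (fun K t τ => (cr F θ hP g₀ os).A K t τ - (cr F θ hP g₀ os).shA K t τ) (fun K t τ => (cr F θ hP g₀ os).B K t τ - (cr F θ hP g₀ os).shB K t τ) δ ∧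
          Summable δ) :
    Spine (N := N) fun F D w => Node00.IsRecordOfRecord₁₃CCoPHOn F N Rg D w :=
  spine_rec13CCoPHOn_of_homes₁₃CoPHOn_holder cr β 𝔯 Rg (s_N14_rRec₁₃CoPHOn_of_n14At 𝔯 Rg h14) h15 h16 h17 h18 h22 h20 h21 hx h19

/-- **N27 = B5 AT THE REGIME RECORD CLASS, β-RATES, N14 FROM END-B UNIFORM LEAVES**: the same knit with `S_N14 (RRec₁₃CoPHOn 𝔯 Rg)` supplied by dag-n14-c's
`s_N14_rRec₁₃CoPHOn_of_uniformLeaves` — at every admissible tuple with provisos in the regime SOME `U : UniformConstants` with `U.Λ` the dressed tower's rate and END-B booking leaves for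
it (dag-n14-a's `n14At_of_uniformLeaves` underneath).  Every hypothesis 0∕1 today. [bookkeeping] -/
theorem spine_rec13CCoPHOn_of_homes₁₃CoPHOn_holder_uniformLeaves
    (h14 : ∀ (F : T4Family) (θ : Stage13HParams F N) (hP : θ.Provisos₁₃CoPH F N), Rg F θ → θ.Admissible F N → ∀ (g₀ : ℕ → ℝ) (os : List (ULoop F)),
      ∃ U : UniformConstants, U.Λ = (𝔯.ne1 F θ hP g₀ os).Λ ∧
        ∀ p K, Nonempty (BookingLeaves U ((𝔯.ne1 F θ hP g₀ os).𝒯.B p K) ((𝔯.ne1 F θ hP g₀ os).𝒯.T p K)))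
    (h15 : S_N15 (RRec₁₃CoPHOn 𝔯 Rg)) (h16 : S_N16Holder β (RRec₁₃CoPHOn 𝔯 Rg)) (h17 : S_N17 (RRec₁₃CoPHOn 𝔯 Rg))
    (h18 : S_N18 (RRec₁₃CoPHOn 𝔯 Rg)) (h22 : S_N22 (RRec₁₃CoPHOn 𝔯 Rg)) (h20 : S_N20 (SRec₁₃CoPHOn cr Rg)) (h21 : S_N21 (SRec₁₃CoPHOn cr Rg))
    (hx : ∀ (F : T4Family) (θ : Stage13HParams F N) (hP : θ.Provisos₁₃CoPH F N), Rg F θ → θ.Admissible F N →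
      B16.EndStatementBPrinted (datumOfRecord₁₃CoPH F N θ hP).C → DagBinding.EndpointExistence (datumOfRecord₁₃CoPH F N θ hP).C.toB12 →
        ForSmallCouplings (datumOfRecord₁₃CoPH F N θ hP) fun g₀ => ∀ os : List (ULoop F),
          0 < (cr F θ hP g₀ os).l₀ ∧ 0 < (cr F θ hP g₀ os).vol ∧
          (∀ (K : ℕ) (t : ℝ), |t| ≤ (cr F θ hP g₀ os).l₀ →
            T4GenFunBounds.schemeZ ((datumOfRecord₁₃CoPH F N θ hP).scheme g₀) os ((cr F θ hP g₀ os).K₀ + K) t =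
              ∑ τ ∈ (cr F θ hP g₀ os).T K, (cr F θ hP g₀ os).A K t τ) ∧
          (∀ (K : ℕ) (t : ℝ), |t| ≤ (cr F θ hP g₀ os).l₀ →
            T4GenFunBounds.schemeZ ((datumOfRecord₁₃CoPH F N θ hP).scheme g₀) os ((cr F θ hP g₀ os).K₀ + K + 1) t =
              ∑ τ ∈ (cr F θ hP g₀ os).T K, (cr F θ hP g₀ os).B K t τ))
    (h19 : ∀ (F : T4Family) (θ : Stage13HParams F N) (hP : θ.Provisos₁₃CoPH F N), Rg F θ → θ.Admissible F N → ∀ (g₀ : ℕ → ℝ) (os : List (ULoop F)),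
      (∀ k : ℕ, RatesHolderAt (datumOfRecord₁₃CoPH F N θ hP) (rateCarriersOfRecord₁₃CoPH 𝔯 F θ hP g₀ os k) β) → letI := (cr F θ hP g₀ os).dec
        ∃ δ : ℕ → ℝ, NE7.Core (cr F θ hP g₀ os).l₀ (cr F θ hP g₀ os).vol (cr F θ hP g₀ os).T (cr F θ hP g₀ os).Bad
          (fun K t τ => (cr F θ hP g₀ os).A K t τ - (cr F θ hP g₀ os).shA K t τ) (fun K t τ => (cr F θ hP g₀ os).B K t τ - (cr F θ hP g₀ os).shB K t τ) δ ∧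
          Summable δ) :
    Spine (N := N) fun F D w => Node00.IsRecordOfRecord₁₃CCoPHOn F N Rg D w :=
  spine_rec13CCoPHOn_of_homes₁₃CoPHOn_holder cr β 𝔯 Rg (s_N14_rRec₁₃CoPHOn_of_uniformLeaves 𝔯 Rg h14) h15 h16 h17 h18 h22 h20 h21 hx h19

/-- **N27 = B5 AT THE REGIME RECORD CLASS, β-RATES, N14 FROM A TOP-BORN DRESSED TOWER** (director-ym №195 (8) reading (a); the `ne1` currency K3⁷ v2 pins BY NAME, plan g78 INBOX
l.24332): the same knit with `S_N14 (RRec₁₃CoPHOn 𝔯 Rg)` supplied by dag-n14-w1's `YMDAG.N14.TopBorn.s_N14_rRec₁₃CoPHOn_of_topBorn` — at every admissible tuple with provisos in the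
regime the reading's dressed tower is TOP-BORN with ONE top-size bound `A₀ ≥ 0` and rate `0 ≤ Λ` (its `N14At` is then the observable budget, `dressedStabilityStrict_iff_of_topBorn`).
Every hypothesis 0∕1 today; reading (a) is an adopted table reading, not a theorem about Bałaban's run. [bookkeeping] -/
theorem spine_rec13CCoPHOn_of_homes₁₃CoPHOn_holder_topBorn
    (h14 : ∀ (F : T4Family) (θ : Stage13HParams F N) (hP : θ.Provisos₁₃CoPH F N), Rg F θ → θ.Admissible F N →
      ∀ (g₀ : ℕ → ℝ) (os : List (ULoop F)), ∃ A₀ : ℝ, 0 ≤ A₀ ∧ 0 ≤ (𝔯.ne1 F θ hP g₀ os).Λ ∧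
        TowerTopBorn (𝔯.ne1 F θ hP g₀ os).𝒯 ∧ TowerTopSizeLe (𝔯.ne1 F θ hP g₀ os).𝒯 A₀)
    (h15 : S_N15 (RRec₁₃CoPHOn 𝔯 Rg)) (h16 : S_N16Holder β (RRec₁₃CoPHOn 𝔯 Rg)) (h17 : S_N17 (RRec₁₃CoPHOn 𝔯 Rg))
    (h18 : S_N18 (RRec₁₃CoPHOn 𝔯 Rg)) (h22 : S_N22 (RRec₁₃CoPHOn 𝔯 Rg)) (h20 : S_N20 (SRec₁₃CoPHOn cr Rg)) (h21 : S_N21 (SRec₁₃CoPHOn cr Rg))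
    (hx : ∀ (F : T4Family) (θ : Stage13HParams F N) (hP : θ.Provisos₁₃CoPH F N), Rg F θ → θ.Admissible F N →
      B16.EndStatementBPrinted (datumOfRecord₁₃CoPH F N θ hP).C → DagBinding.EndpointExistence (datumOfRecord₁₃CoPH F N θ hP).C.toB12 →
        ForSmallCouplings (datumOfRecord₁₃CoPH F N θ hP) fun g₀ => ∀ os : List (ULoop F),
          0 < (cr F θ hP g₀ os).l₀ ∧ 0 < (cr F θ hP g₀ os).vol ∧
          (∀ (K : ℕ) (t : ℝ), |t| ≤ (cr F θ hP g₀ os).l₀ →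
            T4GenFunBounds.schemeZ ((datumOfRecord₁₃CoPH F N θ hP).scheme g₀) os ((cr F θ hP g₀ os).K₀ + K) t =
              ∑ τ ∈ (cr F θ hP g₀ os).T K, (cr F θ hP g₀ os).A K t τ) ∧
          (∀ (K : ℕ) (t : ℝ), |t| ≤ (cr F θ hP g₀ os).l₀ →
            T4GenFunBounds.schemeZ ((datumOfRecord₁₃CoPH F N θ hP).scheme g₀) os ((cr F θ hP g₀ os).K₀ + K + 1) t =
              ∑ τ ∈ (cr F θ hP g₀ os).T K, (cr F θ hP g₀ os).B K t τ))
    (h19 : ∀ (F : T4Family) (θ : Stage13HParams F N) (hP : θ.Provisos₁₃CoPH F N), Rg F θ → θ.Admissible F N → ∀ (g₀ : ℕ → ℝ) (os : List (ULoop F)),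
      (∀ k : ℕ, RatesHolderAt (datumOfRecord₁₃CoPH F N θ hP) (rateCarriersOfRecord₁₃CoPH 𝔯 F θ hP g₀ os k) β) → letI := (cr F θ hP g₀ os).dec
        ∃ δ : ℕ → ℝ, NE7.Core (cr F θ hP g₀ os).l₀ (cr F θ hP g₀ os).vol (cr F θ hP g₀ os).T (cr F θ hP g₀ os).Bad
          (fun K t τ => (cr F θ hP g₀ os).A K t τ - (cr F θ hP g₀ os).shA K t τ) (fun K t τ => (cr F θ hP g₀ os).B K t τ - (cr F θ hP g₀ os).shB K t τ) δ ∧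
          Summable δ) :
    Spine (N := N) fun F D w => Node00.IsRecordOfRecord₁₃CCoPHOn F N Rg D w :=
  spine_rec13CCoPHOn_of_homes₁₃CoPHOn_holder cr β 𝔯 Rg (s_N14_rRec₁₃CoPHOn_of_topBorn 𝔯 Rg h14) h15 h16 h17 h18 h22 h20 h21 hx h19

/-! ## §2 The three at the guard of record `Rg := Node00.unityNondeg₁₃H N` (RR-2's CN class — one application of leaf E short of K3⁷ at `N = 2`) -/

/-- **N27 = B5 AT THE CN RECORD CLASS, β-RATES, N14 READ AS NE1′ AT THE READING'S DRESSED TOWER** — §1 at the guard of record (print's partition of unity `θ.ZhUnity F N` and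
non-degenerate present slots; the K3⁷ skeleton's binder prefix).  Every hypothesis 0∕1 today. [bookkeeping] -/
theorem spine_rec13CCoPHN_of_homes₁₃CoPHOn_holder_n14At
    (h14 : ∀ (F : T4Family) (θ : Stage13HParams F N) (hP : θ.Provisos₁₃CoPH F N), (θ.ZhUnity F N ∧ θ.SlotsNondegenerate₁₃ F N) → θ.Admissible F N →
      ∀ (g₀ : ℕ → ℝ) (os : List (ULoop F)), N14At (𝔯.ne1 F θ hP g₀ os))
    (h15 : S_N15 (RRec₁₃CoPHOn 𝔯 (Node00.unityNondeg₁₃H N))) (h16 : S_N16Holder β (RRec₁₃CoPHOn 𝔯 (Node00.unityNondeg₁₃H N))) (h17 : S_N17 (RRec₁₃CoPHOn 𝔯 (Node00.unityNondeg₁₃H N)))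
    (h18 : S_N18 (RRec₁₃CoPHOn 𝔯 (Node00.unityNondeg₁₃H N))) (h22 : S_N22 (RRec₁₃CoPHOn 𝔯 (Node00.unityNondeg₁₃H N))) (h20 : S_N20 (SRec₁₃CoPHOn cr (Node00.unityNondeg₁₃H N))) (h21 : S_N21 (SRec₁₃CoPHOn cr (Node00.unityNondeg₁₃H N)))
    (hx : ∀ (F : T4Family) (θ : Stage13HParams F N) (hP : θ.Provisos₁₃CoPH F N), (θ.ZhUnity F N ∧ θ.SlotsNondegenerate₁₃ F N) → θ.Admissible F N →
      B16.EndStatementBPrinted (datumOfRecord₁₃CoPH F N θ hP).C → DagBinding.EndpointExistence (datumOfRecord₁₃CoPH F N θ hP).C.toB12 →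
        ForSmallCouplings (datumOfRecord₁₃CoPH F N θ hP) fun g₀ => ∀ os : List (ULoop F),
          0 < (cr F θ hP g₀ os).l₀ ∧ 0 < (cr F θ hP g₀ os).vol ∧
          (∀ (K : ℕ) (t : ℝ), |t| ≤ (cr F θ hP g₀ os).l₀ →
            T4GenFunBounds.schemeZ ((datumOfRecord₁₃CoPH F N θ hP).scheme g₀) os ((cr F θ hP g₀ os).K₀ + K) t =
              ∑ τ ∈ (cr F θ hP g₀ os).T K, (cr F θ hP g₀ os).A K t τ) ∧
          (∀ (K : ℕ) (t : ℝ), |t| ≤ (cr F θ hP g₀ os).l₀ →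
            T4GenFunBounds.schemeZ ((datumOfRecord₁₃CoPH F N θ hP).scheme g₀) os ((cr F θ hP g₀ os).K₀ + K + 1) t =
              ∑ τ ∈ (cr F θ hP g₀ os).T K, (cr F θ hP g₀ os).B K t τ))
    (h19 : ∀ (F : T4Family) (θ : Stage13HParams F N) (hP : θ.Provisos₁₃CoPH F N), (θ.ZhUnity F N ∧ θ.SlotsNondegenerate₁₃ F N) → θ.Admissible F N → ∀ (g₀ : ℕ → ℝ) (os : List (ULoop F)),
      (∀ k : ℕ, RatesHolderAt (datumOfRecord₁₃CoPH F N θ hP) (rateCarriersOfRecord₁₃CoPH 𝔯 F θ hP g₀ os k) β) → letI := (cr F θ hP g₀ os).dec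
        ∃ δ : ℕ → ℝ, NE7.Core (cr F θ hP g₀ os).l₀ (cr F θ hP g₀ os).vol (cr F θ hP g₀ os).T (cr F θ hP g₀ os).Bad
          (fun K t τ => (cr F θ hP g₀ os).A K t τ - (cr F θ hP g₀ os).shA K t τ) (fun K t τ => (cr F θ hP g₀ os).B K t τ - (cr F θ hP g₀ os).shB K t τ) δ ∧
          Summable δ) :
    Spine (N := N) fun F D w => Node00.IsRecordOfRecord₁₃CCoPHN F N D w :=
  spine_rec13CCoPHOn_of_homes₁₃CoPHOn_holder_n14At cr β 𝔯 (Node00.unityNondeg₁₃H N) h14 h15 h16 h17 h18 h22 h20 h21 hx h19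

/-- **N27 = B5 AT THE CN RECORD CLASS, β-RATES, N14 FROM END-B UNIFORM LEAVES** — §1's uniform-leaves form at the guard of record.  Every hypothesis 0∕1 today. [bookkeeping] -/
theorem spine_rec13CCoPHN_of_homes₁₃CoPHOn_holder_uniformLeaves
    (h14 : ∀ (F : T4Family) (θ : Stage13HParams F N) (hP : θ.Provisos₁₃CoPH F N), (θ.ZhUnity F N ∧ θ.SlotsNondegenerate₁₃ F N) → θ.Admissible F N → ∀ (g₀ : ℕ → ℝ) (os : List (ULoop F)),
      ∃ U : UniformConstants, U.Λ = (𝔯.ne1 F θ hP g₀ os).Λ ∧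
        ∀ p K, Nonempty (BookingLeaves U ((𝔯.ne1 F θ hP g₀ os).𝒯.B p K) ((𝔯.ne1 F θ hP g₀ os).𝒯.T p K)))
    (h15 : S_N15 (RRec₁₃CoPHOn 𝔯 (Node00.unityNondeg₁₃H N))) (h16 : S_N16Holder β (RRec₁₃CoPHOn 𝔯 (Node00.unityNondeg₁₃H N))) (h17 : S_N17 (RRec₁₃CoPHOn 𝔯 (Node00.unityNondeg₁₃H N)))
    (h18 : S_N18 (RRec₁₃CoPHOn 𝔯 (Node00.unityNondeg₁₃H N))) (h22 : S_N22 (RRec₁₃CoPHOn 𝔯 (Node00.unityNondeg₁₃H N))) (h20 : S_N20 (SRec₁₃CoPHOn cr (Node00.unityNondeg₁₃H N))) (h21 : S_N21 (SRec₁₃CoPHOn cr (Node00.unityNondeg₁₃H N)))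
    (hx : ∀ (F : T4Family) (θ : Stage13HParams F N) (hP : θ.Provisos₁₃CoPH F N), (θ.ZhUnity F N ∧ θ.SlotsNondegenerate₁₃ F N) → θ.Admissible F N →
      B16.EndStatementBPrinted (datumOfRecord₁₃CoPH F N θ hP).C → DagBinding.EndpointExistence (datumOfRecord₁₃CoPH F N θ hP).C.toB12 →
        ForSmallCouplings (datumOfRecord₁₃CoPH F N θ hP) fun g₀ => ∀ os : List (ULoop F),
          0 < (cr F θ hP g₀ os).l₀ ∧ 0 < (cr F θ hP g₀ os).vol ∧
          (∀ (K : ℕ) (t : ℝ), |t| ≤ (cr F θ hP g₀ os).l₀ →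
            T4GenFunBounds.schemeZ ((datumOfRecord₁₃CoPH F N θ hP).scheme g₀) os ((cr F θ hP g₀ os).K₀ + K) t =
              ∑ τ ∈ (cr F θ hP g₀ os).T K, (cr F θ hP g₀ os).A K t τ) ∧
          (∀ (K : ℕ) (t : ℝ), |t| ≤ (cr F θ hP g₀ os).l₀ →
            T4GenFunBounds.schemeZ ((datumOfRecord₁₃CoPH F N θ hP).scheme g₀) os ((cr F θ hP g₀ os).K₀ + K + 1) t =
              ∑ τ ∈ (cr F θ hP g₀ os).T K, (cr F θ hP g₀ os).B K t τ))
    (h19 : ∀ (F : T4Family) (θ : Stage13HParams F N) (hP : θ.Provisos₁₃CoPH F N), (θ.ZhUnity F N ∧ θ.SlotsNondegenerate₁₃ F N) → θ.Admissible F N → ∀ (g₀ : ℕ → ℝ) (os : List (ULoop F)),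
      (∀ k : ℕ, RatesHolderAt (datumOfRecord₁₃CoPH F N θ hP) (rateCarriersOfRecord₁₃CoPH 𝔯 F θ hP g₀ os k) β) → letI := (cr F θ hP g₀ os).dec
        ∃ δ : ℕ → ℝ, NE7.Core (cr F θ hP g₀ os).l₀ (cr F θ hP g₀ os).vol (cr F θ hP g₀ os).T (cr F θ hP g₀ os).Bad
          (fun K t τ => (cr F θ hP g₀ os).A K t τ - (cr F θ hP g₀ os).shA K t τ) (fun K t τ => (cr F θ hP g₀ os).B K t τ - (cr F θ hP g₀ os).shB K t τ) δ ∧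
          Summable δ) :
    Spine (N := N) fun F D w => Node00.IsRecordOfRecord₁₃CCoPHN F N D w :=
  spine_rec13CCoPHOn_of_homes₁₃CoPHOn_holder_uniformLeaves cr β 𝔯 (Node00.unityNondeg₁₃H N) h14 h15 h16 h17 h18 h22 h20 h21 hx h19

/-- **N27 = B5 AT THE CN RECORD CLASS, β-RATES, N14 FROM A TOP-BORN DRESSED TOWER** — §1's top-born form at the guard of record (the form K3⁷ v2 DRAFT-2 reads at `PHolderD4`'s N14
conjunct once `ne1 :=` n14-w1's unit-scale tower).  Every hypothesis 0∕1 today. [bookkeeping] -/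
theorem spine_rec13CCoPHN_of_homes₁₃CoPHOn_holder_topBorn
    (h14 : ∀ (F : T4Family) (θ : Stage13HParams F N) (hP : θ.Provisos₁₃CoPH F N), (θ.ZhUnity F N ∧ θ.SlotsNondegenerate₁₃ F N) → θ.Admissible F N →
      ∀ (g₀ : ℕ → ℝ) (os : List (ULoop F)), ∃ A₀ : ℝ, 0 ≤ A₀ ∧ 0 ≤ (𝔯.ne1 F θ hP g₀ os).Λ ∧
        TowerTopBorn (𝔯.ne1 F θ hP g₀ os).𝒯 ∧ TowerTopSizeLe (𝔯.ne1 F θ hP g₀ os).𝒯 A₀)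
    (h15 : S_N15 (RRec₁₃CoPHOn 𝔯 (Node00.unityNondeg₁₃H N))) (h16 : S_N16Holder β (RRec₁₃CoPHOn 𝔯 (Node00.unityNondeg₁₃H N))) (h17 : S_N17 (RRec₁₃CoPHOn 𝔯 (Node00.unityNondeg₁₃H N)))
    (h18 : S_N18 (RRec₁₃CoPHOn 𝔯 (Node00.unityNondeg₁₃H N))) (h22 : S_N22 (RRec₁₃CoPHOn 𝔯 (Node00.unityNondeg₁₃H N))) (h20 : S_N20 (SRec₁₃CoPHOn cr (Node00.unityNondeg₁₃H N))) (h21 : S_N21 (SRec₁₃CoPHOn cr (Node00.unityNondeg₁₃H N)))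
    (hx : ∀ (F : T4Family) (θ : Stage13HParams F N) (hP : θ.Provisos₁₃CoPH F N), (θ.ZhUnity F N ∧ θ.SlotsNondegenerate₁₃ F N) → θ.Admissible F N →
      B16.EndStatementBPrinted (datumOfRecord₁₃CoPH F N θ hP).C → DagBinding.EndpointExistence (datumOfRecord₁₃CoPH F N θ hP).C.toB12 →
        ForSmallCouplings (datumOfRecord₁₃CoPH F N θ hP) fun g₀ => ∀ os : List (ULoop F),
          0 < (cr F θ hP g₀ os).l₀ ∧ 0 < (cr F θ hP g₀ os).vol ∧
          (∀ (K : ℕ) (t : ℝ), |t| ≤ (cr F θ hP g₀ os).l₀ →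
            T4GenFunBounds.schemeZ ((datumOfRecord₁₃CoPH F N θ hP).scheme g₀) os ((cr F θ hP g₀ os).K₀ + K) t =
              ∑ τ ∈ (cr F θ hP g₀ os).T K, (cr F θ hP g₀ os).A K t τ) ∧
          (∀ (K : ℕ) (t : ℝ), |t| ≤ (cr F θ hP g₀ os).l₀ →
            T4GenFunBounds.schemeZ ((datumOfRecord₁₃CoPH F N θ hP).scheme g₀) os ((cr F θ hP g₀ os).K₀ + K + 1) t =
              ∑ τ ∈ (cr F θ hP g₀ os).T K, (cr F θ hP g₀ os).B K t τ))
    (h19 : ∀ (F : T4Family) (θ : Stage13HParams F N) (hP : θ.Provisos₁₃CoPH F N), (θ.ZhUnity F N ∧ θ.SlotsNondegenerate₁₃ F N) → θ.Admissible F N → ∀ (g₀ : ℕ → ℝ) (os : List (ULoop F)),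
      (∀ k : ℕ, RatesHolderAt (datumOfRecord₁₃CoPH F N θ hP) (rateCarriersOfRecord₁₃CoPH 𝔯 F θ hP g₀ os k) β) → letI := (cr F θ hP g₀ os).dec
        ∃ δ : ℕ → ℝ, NE7.Core (cr F θ hP g₀ os).l₀ (cr F θ hP g₀ os).vol (cr F θ hP g₀ os).T (cr F θ hP g₀ os).Bad
          (fun K t τ => (cr F θ hP g₀ os).A K t τ - (cr F θ hP g₀ os).shA K t τ) (fun K t τ => (cr F θ hP g₀ os).B K t τ - (cr F θ hP g₀ os).shB K t τ) δ ∧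
          Summable δ) :
    Spine (N := N) fun F D w => Node00.IsRecordOfRecord₁₃CCoPHN F N D w :=
  spine_rec13CCoPHOn_of_homes₁₃CoPHOn_holder_topBorn cr β 𝔯 (Node00.unityNondeg₁₃H N) h14 h15 h16 h17 h18 h22 h20 h21 hx h19

end Summit.QuantumFields.YangMills.Theorems.BalabanUVNodesN27SpineRecord
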